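import Summits.PneNP.PneNP.Theses.OneSlice
import Summits.PneNP.PneNP.Theorems.SingleThreshold.Negative.LoadBearing
import Literature.Computability.Complexity.RossmanMonotoneCliqueFinite
import Literature.Computability.Complexity.RossmanMonotoneCliqueThm2Proofs
import Literature.Computability.Complexity.RossmanMonotoneCliqueLemma23Proofs
import Literature.Computability.Complexity.CliqueThresholdBounds
import Literature.Computability.Complexity.GnpSprinkling

/-!
# Line `self-noise-closure` for crux `SingleThreshold` (stmt-PneNP-2833) — checked skeleton

Route `OneSlice` (route-PneNP-OneSlice); crux `Summit.PneNP.PneNP.Theses.OneSlice.SingleThreshold`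
(Rossman's single-threshold problem, unbounded-exponent form: `∀ c ∃ k ≥ 3 ∃ δ > 0 ∀ᶠ n`, every
monotone `{∧₂,∨₂}`-circuit that is `δ`-accurate for `k`-CLIQUE on `G(n, p_c)`, `p_c = n^{-2/(k-1)}`,
has more than `n^c` gates). Planner skeleton (crux-plan, round 1), unit
`cruxplan-stmt-PneNP-2833-self-noise-closure`; idea card `Ideas/self-noise-closure.md` (triage r1-2:
pass with mandatory sharpen; r1-3: pass with mandatory sharpen — both sharpenings applied below).

**Idea.** Run Rossman's ⋆-closure (Def. 8, Lemmas 9–16 of FOCS'10; in tree as `IsClosedFn`,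
`starClosure`, `StarApproxInv`, `card_minterms_le_of_isClosedFn`, `one_sub_lt_prob_of_dense`,
`card_covered_cliques_le` — all PARAMETRIC in the bias) with respect to the CRITICAL law `G(n,p_c)`
itself instead of the subcritical sprinkle `G(n,p^{1+δ})`, with a polynomially small trigger
`θ = n^{-a}`, `a ≥ k + c` (so that Lemma 13's error `L·|I ∪ J|·θ ≤ 2^{C(k-1,2)}/n → 0` for programs of
length `L ≤ n^c`, as `|I ∪ J| ≤ C(n,k-1)2^{C(k-1,2)}`). Two of the three uses of the second density in Rossman's proof become FREE at one
density: (Case 1 = Lemma 15) a dense family of isolated `K_A − e` accepted by the closed output `f̄`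
forces `Pr[f̄(G(n,p_c)) = 1] → 1`, because every proper subgraph of `K_k` is strictly ABOVE its
threshold at `p_c` (strict balance; the spread condition has uniform slack `n^{2/(k-1)}`), which
contradicts the `γ`-REJECTION that accuracy gives for free (`Pr[ω_k = 0] ≥ e^{-2}`); (Case 2 = Lemmas
14, 16, 9) a dense family of exact clique minterms of `f̄` forces `L ≥ n^{(k+1)/4 - o(1)} > n^c` for
`k ≥ 4c + 1`, because Lemma 9's count at bias `p_c` and trigger `n^{-a}` is
`(B·a·log n / p_c)^s` per edge-shape and the `J`-bottleneck exponent `supp − (2/(k−1))·edges ≥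
(k²+7)/(4(k−1))` is intact. What is NOT free is the passage from NOISY planted acceptance
`Pr_{G,A}[f̄(G ∪ K_A) = 1] ≥ 1 − δ` (Lemma 23, proved in tree, applied to the accurate `f̄`) to
ISOLATED acceptance `Pr_A[f̄(K_A) = 1] ≥ η` — the card's crux-let **PositiveTrigger**, the one place
where the single density is paid for, at the OUTPUT gate, on the POSITIVE side (`stub_positiveTrigger`,
OPEN, hardest; stated for the structural critical closure of the program, with `f̄`'s two-sided
accuracy AND its planted acceptance as hypotheses — triage repairs R1/R2/S3/S4).

**Stubs (5, registered).**
* `stub_structuralApprox` (M, provable now): Rossman's ⋆-closed approximation with its CONSTRUCTION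
  exported (inputs exact, `∧` exact, `∨ ↦ (·∨·)⋆`) together with `StarApproxInv` — the induction of
  `exists_closedApprox`, generic in the bias/trigger/classes.
* `stub_plantedAcceptance` (M, provable now): accuracy at `p_c` ⇒ noisy planted acceptance, for every
  monotone `f` (Lemma 23 `Rossman2010_plantedVsConditioned_holds` + `Pr[ω_k = 1] ≥ Ω_k(1)` +
  `sum_cliqueFree_mul_kSubsetProb_false_le`).
* `stub_selfNoiseLemma15` (M, provable now): Lemma 15 at ONE density — an `η`-dense family of accepted
  isolated `K_A − e` forces `Pr[f(G(n,p_c)) = 1] > 1 − ε`, every monotone `f`, every `η, ε > 0`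
  (`one_sub_lt_prob_of_dense` at `p = p_c`; slack `2·|Z| ≤ (k−1)·verts(Z) − 2`).
* `stub_fewCliqueMinterms` (M, provable now): Lemma 16 + Lemma 9 at `(p_c, n^{-a})` — if the exact
  clique minterms of `f` are covered by medium minterms of `L ≤ n^c` closed monotone functions, their
  density is eventually below any `η > 0` once `k ≥ 4c + 1` (`card_covered_cliques_le` + the critical
  signature-weight estimate `n^{2s/(k−1) − v} ≤ n^{−(k+1)/4 − 2/(k−1)}` from `medJ_ineq`).
* `stub_positiveTrigger` (open-problem, HARDEST): for `k ≥ k₀(c)` and the structural closed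
  approximation of a monotone program of length `≤ n^c` at `(p_c, n^{-a}, smallI ∪ medJ)`: if its output
  `f̄` is `δ`-accurate for `k`-CLIQUE on `G(n,p_c)` and rejects the planted `G ∪ K_A` with probability
  `≤ δ`, then `f̄` accepts an `η`-fraction of the ISOLATED `k`-cliques.

Composition `SingleThreshold_of : SingleThreshold` is sorry-free: it is Theorem 1's dichotomy
(`thm1_finite`) run at one large `n` at the critical density, using the five stubs BY NAME and the
landed Negative lemma `singleThreshold_iff_lib` (crux ≡ `∀ c ∃ k ≥ 3 ∃ δ > 0, LowerBoundAt c k δ`).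
Disproof/Negative obligations honoured (see the line card): `_false_without_basis` (the `{∧₂,∨₂}`
structure enters through `stub_structuralApprox`/`StarApproxInv` and Lemma 14 in Case 2),
`_false_without_accuracy` (accuracy enters three times: `γ`-rejection in Case 1, planted acceptance,
and as PositiveTrigger's hypothesis), `witness_delta_le` (`δ = δ(k) ≤ e^{-2}/4` chosen after `k`),
`witness_exponent_lt` / `lowerBoundAt_of_le_one` (`k ≥ 4c + 5`), `not_singleThresholdSubcritical/Dense`
(the critical scaling is used in BOTH free cases), `singleThreshold_iff_aas` (the residual is stated at
constant `δ`, not assumed away). No stub is an instance of a refuted statement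
(`ledger negatives --problem PneNP`: 5 items, none on cliques/thresholds).
**For provers restating a stub** in `Summits/PneNP/PneNP/Theorems/…` (`propose --supports stmt-PneNP-2833`):
copy the statement verbatim under the same short name with this file's context —
`open Finset Filter`, `open scoped Classical Topology`, `open Literature.Computability.Complexity GateList`,
`open Summit.PneNP.PneNP.Theorems.SingleThreshold.Negative (Edges pc)` (`Edges n = (⊤ : SimpleGraph (Fin n)).edgeSet`,
`pc n k = (n : ℝ) ^ (-(2 : ℝ) / ((k : ℝ) - 1))`, both from the landed `Negative/LoadBearing.lean`).
-/

noncomputable section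

set_option linter.dupNamespace false

open Finset Filter
open scoped Classical Topology

namespace Summit.PneNP.PneNP.Cruxes.SingleThreshold.SelfNoiseClosure

open Literature.Computability.Complexity GateList
open Summit.PneNP.PneNP.Theorems.SingleThreshold.Negative (Edges pc err LowerBoundAt
  singleThreshold_iff_lib pc_nonneg pc_le_one tendsto_pc gnpProb_union_le)

/-! ## Registered stubs (the ONLY `sorry`s of the line) -/

/-- **Stub 1 — the structural ⋆-closed approximation (M, provable now).** For a bias `0 ≤ p ≤ 1`,
a trigger `0 ≤ t < 1 − p` and classes `I, J` with all single-coordinate vectors in `I` and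
`I ⊔ I ⊆ I ∪ J`, every well-formed `{∧₂,∨₂}`-program `gs` has wire approximators `ap` which are
(a) exact on inputs, (b) exact conjunctions at `∧`-gates, (c) the ⋆-closure (w.r.t. `(p, t, I ∪ J)`) of
the disjunction at `∨`-gates, and (d) satisfy Rossman's invariant `StarApproxInv` (monotone, ⋆-closed,
dominating, Lemma 13 error `≤ #gates·|I ∪ J|·t`, Lemma 14 locality). Why true: this is the induction of
the tree's `exists_closedApprox` (`StarApproxInv.nil` / `.snoc`) with the construction, which that proof
performs but does not export, recorded in the conclusion; earlier wires keep their approximators when a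
gate is appended, and every gate over `monotoneBasis` is an `andGate` or an `orGate`
(`exists_eq_andGate_of_fn_eq` / `exists_eq_orGate_of_fn_eq`). Used here at the CRITICAL bias `p = p_c`
("self-noise"). [cite: Rossman2010, §5.2, Lemmas 13–14 (p. 8)] -/
theorem stub_structuralApprox {ι : Type*} [Fintype ι] [DecidableEq ι] {p t : ℝ}
    (hp0 : 0 ≤ p) (hp1 : p ≤ 1) (ht : 0 ≤ t) (htp : t < 1 - p)
    {I J : Finset (ι → Bool)} (hI1 : ∀ i, indVec {i} ∈ I)
    (hIJ : ∀ x ∈ I, ∀ y ∈ I, x ⊔ y ∈ I ∪ J)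
    (gs : List (Gate ι)) (hwf : GateList.WF gs) (hB : ∀ g ∈ gs, g.fn ∈ monotoneBasis) :
    ∃ ap : ι ⊕ ℕ → (ι → Bool) → Bool,
      (∀ i, ap (Sum.inl i) = fun x => x i) ∧
      (∀ (m : ℕ) (u v : ι ⊕ ℕ), gs[m]? = some (GateList.andGate u v) →
          ap (Sum.inr m) = fun x => ap u x && ap v x) ∧
      (∀ (m : ℕ) (u v : ι ⊕ ℕ), gs[m]? = some (GateList.orGate u v) →
          ap (Sum.inr m) = starClosure p t (I ∪ J) (fun x => ap u x || ap v x)) ∧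
      StarApproxInv p t I J gs ap := by
  sorry

/-- **Stub 2 — accuracy at the threshold gives noisy planted acceptance (M, provable now).** For
`k ≥ 5` and every `δ₁ > 0` there is `δ > 0` such that eventually in `n`: every MONOTONE graph
function `f` with `Pr_{G ∼ G(n,p_c)}[f(G) ≠ CLIQUE_k(G)] ≤ δ` rejects the planted input `G ∪ K_A`
(`G ∼ G(n,p_c)`, `A` a uniform `k`-set) with probability `≤ δ₁`:
`Σ_x w_{p_c}(x) · Pr_A[f(x ∪ K_A) = 0] ≤ δ₁`. Why true: on `{ω_k(x) = 0}` this is Lemma 17's second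
inequality `sum_cliqueFree_mul_kSubsetProb_false_le` (error/`Pr[ω_k = 1]` + the Lemma-23 distance,
`Rossman2010_plantedVsConditioned_holds`, which → 0 at `p = p_c ∈ Θ(n^{-2/(k-1)})`), with
`Pr[ω_k = 1] ≥ a_k > 0` eventually (`eventually_le_gnpProb_cliqueCount_eq_one`); on `{ω_k(x) ≥ 1}`
monotonicity gives `f(x ∪ K_A) = 0 ⇒ f(x) = 0 ≠ CLIQUE_k(x)`, an error of `f`; take
`δ = a_k δ₁ / 3`. (`x ∪ K_A = x ⊔ cliqueVec A = plantClique A x`, `plantClique_eq_sup`.)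
[cite: Rossman2010, Lemma 23 and App. B, proof of Lemma 17 (pp. 13–14)] -/
theorem stub_plantedAcceptance :
    ∀ k : ℕ, 5 ≤ k → ∀ δ₁ : ℝ, 0 < δ₁ → ∃ δ : ℝ, 0 < δ ∧ ∀ᶠ n : ℕ in atTop,
      ∀ f : (Edges n → Bool) → Bool, Monotone f →
        gnpProb n (pc n k) (univ.filter fun x => f x ≠ cliqueFn n k x) ≤ δ →
          (∑ x : Edges n → Bool, gnpWeight n (pc n k) x *
              kSubsetProb n k (fun A => f (x ⊔ cliqueVec A) = false)) ≤ δ₁ := by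
  sorry

/-- **Stub 3 — Lemma 15 at ONE density: accepted isolated cliques-minus-an-edge force acceptance of
the critical graph (M, provable now; the card's `SelfNoiseMinterms` in fraction form, triage S3).**
For `k ≥ 3` and all `η, ε > 0`, eventually in `n`: if a monotone `f` accepts `K_A − e` (some edge `e`
of `K_A` switched off) for an `η`-fraction of the `k`-sets `A`, then `Pr[f(G(n,p_c)) = 1] > 1 − ε`.
Why true: `one_sub_lt_prob_of_dense` (the tree's spread-lemma form of Lemma 15) at the CRITICAL bias
`p = p_c ≤ 1/2`, with `θ = η`, `ℓ = C(k,2) − 1`, `R = B·log(ℓ/ε')·n^{2/(k-1)}`, `Q A = K_A − e_A`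
(`supp_update_cliqueVec`): its spread condition `R^{|Z|} k^{verts Z} ≤ η n^{verts Z}` holds for every
non-empty `Z ⊆ E(K_A − e)` because `2|Z| ≤ (k−1)·verts(Z) − 2` for every such `Z` (a subgraph of `K_k`
missing an edge: `v ≤ k−1 ⇒ 2|Z| ≤ v(v−1) ≤ (k−1)v − 2`; `v = k ⇒ 2|Z| ≤ k(k−1) − 2`), i.e. every
proper subgraph of `K_k` is strictly supercritical at `p_c` (strict balance of `K_k`) with uniform
slack `n^{2/(k-1)}` against the constants `R₀^{k²} k^k / η`. No second density, no closure.
[cite: Rossman2010, Lemma 15 (p. 9); Bell2023 (spread lemma, in tree)] -/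
theorem stub_selfNoiseLemma15 :
    ∀ k : ℕ, 3 ≤ k → ∀ η ε : ℝ, 0 < η → 0 < ε → ∀ᶠ n : ℕ in atTop,
      ∀ f : (Edges n → Bool) → Bool, Monotone f →
        η ≤ kSubsetProb n k (fun A => ∃ e, cliqueVec A e = true ∧
              f (Function.update (cliqueVec A) e false) = true) →
          1 - ε < gnpProb n (pc n k) (univ.filter fun x => f x = true) := by
  sorry

/-- **Stub 4 — Lemmas 16 + 9 at the critical bias with a polynomial trigger: covered clique minterms
are rare (M, provable now; the card's `SelfClosedFewMinterms` assembled).** For `k ≥ 4c + 1` (and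
`k ≥ 3`, `a ≥ 1`) and every `η > 0`, eventually in `n`: for `L ≤ n^c` monotone functions `g m`, each
⋆-closed w.r.t. `(p_c, n^{-a}, smallI ∪ medJ)`, and any `f` whose exact clique minterms `K_A` are all
COVERED (some `g m` has a minterm `H ∈ J`, `H ⊆ K_A` — the output of Lemma 14 / `StarApproxInv.loc`),
the density of `{A : K_A ∈ M(f)}` is `< η`. Why true: `card_covered_cliques_le` bounds the count by
`L · C(n,k) · Σ_σ sigWeight n k p_c n^{-a} σ` over the `≤ k(k²+1)` signatures `σ = (v,s)` of `J`; at
`p = p_c`, `t = n^{-a}` one has `sigWeight (v,s) = (B(log s + a log n) n^{2/(k-1)})^s (k/n)^v ≤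
(B(2 log k + a log n))^{k²} k^k · n^{2s/(k-1) − v}` and `2s/(k−1) − v ≤ −(k²+7)/(4(k−1)) ≤ −(k+1)/4 −
2/(k−1)` by `medJ_ineq`, so the polylog is absorbed by `n^{-2/(k-1)}` and the density is
`≤ L k(k²+1) n^{-(k+1)/4} ≤ k(k²+1) n^{c − (k+1)/4} ≤ k(k²+1) n^{-1/2} → 0`.
[cite: Rossman2010, Lemma 9 (p. 7), Lemma 16 and end of §6 (p. 9)] -/
theorem stub_fewCliqueMinterms :
    ∀ c k a : ℕ, 4 * c + 1 ≤ k → 3 ≤ k → 1 ≤ a → ∀ η : ℝ, 0 < η → ∀ᶠ n : ℕ in atTop,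
      ∀ (L : ℕ) (g : ℕ → (Edges n → Bool) → Bool) (f : (Edges n → Bool) → Bool),
        L ≤ n ^ c →
        (∀ m < L, Monotone (g m) ∧
            IsClosedFn (pc n k) ((n : ℝ) ^ (-(a : ℝ))) (smallI n k ∪ medJ n k) (g m)) →
        (∀ A : Finset (Fin n), #A = k → IsMinterm f (cliqueVec A) →
            ∃ m < L, ∃ H ∈ medJ n k, IsMinterm (g m) H ∧ H ≤ cliqueVec A) →
          kSubsetProb n k (fun A => IsMinterm f (cliqueVec A)) < η := by
  sorry

/-- **Stub 5 — PositiveTrigger (OPEN — the crux-let; hardest stub).** For every exponent `c` there are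
arbitrarily large clique sizes `k` (`∀ k₀ ∃ k ≥ k₀`; the composition asks for `k ≥ 4c + 5`) admitting
a trigger exponent `a ≥ k + c` and constants `δ, η > 0` with, eventually in `n`: for every well-formed `{∧₂,∨₂}`-program `gs` of length `≤ n^c`,
output wire `out`, and its STRUCTURAL ⋆-closed approximation `ap` at the critical bias
(`p = p_c = n^{-2/(k-1)}`, trigger `θ = n^{-a}`, classes `smallI ∪ medJ`; inputs exact, `∧` exact,
`∨ ↦ (·∨·)⋆`, hence `StarApproxInv`) — writing `f̄ = ap out` — IF `f̄` is `δ`-accurate for `k`-CLIQUE on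
`G(n,p_c)` AND `f̄` rejects the planted `G ∪ K_A` with probability `≤ δ`, THEN `f̄` accepts an
`η`-fraction of the ISOLATED cliques `K_A`. This is the only step where the single density is paid
for: with isolated acceptance in hand, Case 1 (stub 3, contradicting the `γ`-rejection that accuracy
gives) and Case 2 (stub 4 + Lemma 14, contradicting `L ≤ n^c`) finish exactly as in Theorem 1.
Why it might be true for circuit-generated `f̄` although false for general closed functions (card,
§Lever (a)/(b)): a wire that is `(1−θ)`-sure on `G(n,p_c)` is the constant `1` (`⊥ ∈ smallI`, closed),
so sure junk is erased with booked error; `∧` of closed functions sure on the planted PRODUCT law has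
both children sure; at `∨̄`-gates Harris' inequality on the planted product law makes one child
`(1−√τ)`-sure (square-root loss per alternation — affordable for polynomial accuracy within `O(1)`
levels, NOT in general: triage doubt); accuracy pins `Pr[f̄ = 1] = 1 − e^{-1/k!} ± δ` and forces the
accepting minterms below `G ∪ K_A` to contain `K_A` for most `(G, A)` (else a heavier false positive
`G ∪ K_A − e`), so the violator is exactly N7's "conditional junk" `K_A ∪ S`, `S ⊆ G` large. Why it
might fail / why it is hard: it is crux-equivalent modulo stubs 1–4 (a small `δ`-accurate `C` is
exactly a violator, `singleThreshold_iff_aas`); every per-gate sureness budget is killed by live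
counting gates (`T_{≥t}`, `|t − m| ≤ √m`, flip rate `Θ(k²/√m)` ≫ `n^{-c}`; TRIAGE r1-2/r1-3 common
lesson), so the argument must follow accepting descents from the output, never sum over gates. First
milestone inside this stub (new as a theorem if reached): the same statement with `δ = n^{-C_k}`
(polynomial accuracy ⇒ the trigger fires at the output up to the "sure-OR leak" count SureOrCount of
the card). Triage witnesses honoured: W1 (OR of `M` fixed edges) and the bare threshold `T_{≥t}` violate
the accuracy hypothesis; W2 (`CLIQUE₃ ∧ T`) is excluded by `k ≥ k₀(c)` (R2); the input wire `x_e`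
(`gs = []`) forces `δ < 1/k!` (`witness_delta_le`), allowed since `δ = δ(k)`.
[cite: Rossman2010, §9 (p. 11, the open single-threshold problem); Rossman2014; this crux's
Ideas/self-noise-closure.md, TRIAGE-r1-2.md, TRIAGE-r1-3.md] -/
theorem stub_positiveTrigger :
    ∀ c k₀ : ℕ, ∃ k : ℕ, k₀ ≤ k ∧ ∃ a : ℕ, k + c ≤ a ∧ ∃ δ : ℝ, 0 < δ ∧ ∃ η : ℝ, 0 < η ∧
      ∀ᶠ n : ℕ in atTop,
        ∀ (gs : List (Gate (Edges n))) (out : Edges n ⊕ ℕ)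
          (ap : Edges n ⊕ ℕ → (Edges n → Bool) → Bool),
          GateList.WF gs → (∀ g ∈ gs, g.fn ∈ monotoneBasis) → gs.length ≤ n ^ c →
          GateList.OutOK gs.length out →
          (∀ i, ap (Sum.inl i) = fun x => x i) →
          (∀ (m : ℕ) (u v : Edges n ⊕ ℕ), gs[m]? = some (GateList.andGate u v) →
              ap (Sum.inr m) = fun x => ap u x && ap v x) →
          (∀ (m : ℕ) (u v : Edges n ⊕ ℕ), gs[m]? = some (GateList.orGate u v) →
              ap (Sum.inr m) = starClosure (pc n k) ((n : ℝ) ^ (-(a : ℝ))) (smallI n k ∪ medJ n k)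
                (fun x => ap u x || ap v x)) →
          StarApproxInv (pc n k) ((n : ℝ) ^ (-(a : ℝ))) (smallI n k) (medJ n k) gs ap →
          gnpProb n (pc n k) (univ.filter fun x => ap out x ≠ cliqueFn n k x) ≤ δ →
          (∑ x : Edges n → Bool, gnpWeight n (pc n k) x *
              kSubsetProb n k (fun A => ap out (x ⊔ cliqueVec A) = false)) ≤ δ →
            η ≤ kSubsetProb n k (fun A => ap out (cliqueVec A) = true) := by
  sorry

/-! ## Glue lemmas (sorry-free) -/

/-- Union bound through an intermediate function: `Pr[f ≠ h] ≤ Pr[f ≠ g] + Pr[g ≠ h]`. [folklore] -/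
theorem gnpProb_ne_le_add {n : ℕ} {q : ℝ} (hq0 : 0 ≤ q) (hq1 : q ≤ 1)
    (f g h : (Edges n → Bool) → Bool) :
    gnpProb n q (univ.filter fun x => f x ≠ h x) ≤
      gnpProb n q (univ.filter fun x => f x ≠ g x) + gnpProb n q (univ.filter fun x => g x ≠ h x) := by
  refine le_trans (gnpProb_mono hq0 hq1 ?_) (gnpProb_union_le hq0 hq1 _ _)
  intro x hx
  simp only [mem_filter, mem_univ, true_and, mem_union] at hx ⊢
  by_contra hc
  push Not at hc
  exact hx (hc.1.trans hc.2)

/-- The negative side for free: `Pr[f = 1] ≤ Pr[f ≠ CLIQUE_k] + (1 − Pr[ω_k = 0])`. [folklore] -/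
theorem gnpProb_true_le {n k : ℕ} {q : ℝ} (hq0 : 0 ≤ q) (hq1 : q ≤ 1)
    (f : (Edges n → Bool) → Bool) :
    gnpProb n q (univ.filter fun x => f x = true) ≤
      gnpProb n q (univ.filter fun x => f x ≠ cliqueFn n k x) +
        (1 - gnpProb n q (univ.filter fun x => cliqueCount n k x = 0)) := by
  have hcompl : gnpProb n q (univ.filter fun x : Edges n → Bool => cliqueFn n k x = true) =
      1 - gnpProb n q (univ.filter fun x => cliqueCount n k x = 0) := by
    have h := gnpProb_compl q (univ.filter fun x : Edges n → Bool => cliqueFn n k x = true)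
    have hset : (univ.filter fun x : Edges n → Bool => cliqueFn n k x = true)ᶜ =
        univ.filter fun x => cliqueCount n k x = 0 := by
      ext x
      simp only [mem_compl, mem_filter, mem_univ, true_and, cliqueCount_eq_zero_iff,
        Bool.not_eq_true]
    rw [hset] at h
    linarith
  rw [← hcompl]
  refine le_trans (gnpProb_mono hq0 hq1 ?_) (gnpProb_union_le hq0 hq1 _ _)
  intro x hx
  simp only [mem_filter, mem_univ, true_and, mem_union] at hx ⊢
  by_cases hc : cliqueFn n k x = true
  · exact Or.inr hc
  · left
    rw [hx]
    exact fun h' => hc h'.symm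

/-- `|I ∪ J| ≤ C(n,k-1) · 2^{C(k-1,2)}`: every graph in `I ∪ J` has at most `k - 1` non-isolated
vertices (`mem_smallI`, `medJ_ineq`), and `card_filter_card_supp_le`. [cite: Rossman2010, Lemma 10 (p. 7)] -/
theorem card_smallI_union_medJ_le_pred {n k : ℕ} (hk : 1 ≤ k) (hkn : k ≤ n) :
    #(smallI n k ∪ medJ n k) ≤ n.choose (k - 1) * 2 ^ (k - 1).choose 2 := by
  refine le_trans (card_le_card fun z hz => ?_) (card_filter_card_supp_le (by omega))
  rw [mem_filter]
  refine ⟨mem_univ _, ?_⟩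
  rw [mem_union] at hz
  rcases hz with hz | hz
  · rw [mem_smallI] at hz; omega
  · exact (by have := (medJ_ineq hz).2.1; omega)

/-- The error budget of Lemma 13 at the critical bias is eventually below any `δ > 0`:
`n^c · (C(n,k-1) 2^{C(k-1,2)}) · n^{-a} ≤ 2^{C(k-1,2)} / n` for `a ≥ k + c`. [folklore] -/
theorem eventually_errBudget_le {c k a : ℕ} (hk : 1 ≤ k) (hka : k + c ≤ a) {δ : ℝ} (hδ : 0 < δ) :
    ∀ᶠ n : ℕ in atTop,
      (n : ℝ) ^ c * (((n.choose (k - 1) * 2 ^ (k - 1).choose 2 : ℕ)) : ℝ) * (n : ℝ) ^ (-(a : ℝ)) ≤ δ := by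
  have hlim : Tendsto (fun n : ℕ => (2 : ℝ) ^ (k - 1).choose 2 * (n : ℝ)⁻¹) atTop (𝓝 0) := by
    have h := (tendsto_inv_atTop_nhds_zero_nat (𝕜 := ℝ)).const_mul ((2 : ℝ) ^ (k - 1).choose 2)
    rw [mul_zero] at h
    exact h
  filter_upwards [hlim.eventually (gt_mem_nhds hδ), eventually_ge_atTop 1] with n hn hn1
  have hnr : (1 : ℝ) ≤ n := by exact_mod_cast hn1
  have hn0 : (0 : ℝ) < n := by linarith
  have hchoose : ((n.choose (k - 1) : ℕ) : ℝ) ≤ (n : ℝ) ^ (k - 1) := by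
    exact_mod_cast Nat.choose_le_pow n (k - 1)
  have hpow : (n : ℝ) ^ c * (n : ℝ) ^ (k - 1) * (n : ℝ) ^ (-(a : ℝ)) ≤ (n : ℝ)⁻¹ := by
    rw [← Real.rpow_natCast (n : ℝ) c, ← Real.rpow_natCast (n : ℝ) (k - 1), ← Real.rpow_add hn0,
      ← Real.rpow_add hn0, ← Real.rpow_neg_one]
    refine Real.rpow_le_rpow_of_exponent_le hnr ?_
    have h1 : ((k + c : ℕ) : ℝ) ≤ a := by exact_mod_cast hka
    have h2 : (((k - 1 : ℕ)) : ℝ) = (k : ℝ) - 1 := by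
      rw [Nat.cast_sub hk]; push_cast; ring
    push_cast at h1
    rw [h2]
    linarith
  calc (n : ℝ) ^ c * (((n.choose (k - 1) * 2 ^ (k - 1).choose 2 : ℕ)) : ℝ) * (n : ℝ) ^ (-(a : ℝ))
      = (2 : ℝ) ^ (k - 1).choose 2 *
          ((n : ℝ) ^ c * ((n.choose (k - 1) : ℕ) : ℝ) * (n : ℝ) ^ (-(a : ℝ))) := by
        push_cast; ring
    _ ≤ (2 : ℝ) ^ (k - 1).choose 2 * ((n : ℝ) ^ c * (n : ℝ) ^ (k - 1) * (n : ℝ) ^ (-(a : ℝ))) := by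
        refine mul_le_mul_of_nonneg_left ?_ (by positivity)
        refine mul_le_mul_of_nonneg_right ?_ (Real.rpow_nonneg hn0.le _)
        exact mul_le_mul_of_nonneg_left hchoose (by positivity)
    _ ≤ (2 : ℝ) ^ (k - 1).choose 2 * (n : ℝ)⁻¹ := mul_le_mul_of_nonneg_left hpow (by positivity)
    _ ≤ δ := hn.le

/-! ## Composition (sorry-free): the five stubs give the crux BY NAME -/

/-- **`SingleThreshold` from the five registered stubs** — Theorem 1's dichotomy at ONE density.
Given `c`: `k ≥ 4c+5`, trigger exponent `a`, tolerances `δ_P, η` from `stub_positiveTrigger`,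
`δ_A` from `stub_plantedAcceptance` at level `δ_P`, and `δ := min(δ_P, δ_A, e^{-2})/4`. At a large `n`,
for a `δ`-accurate monotone `C` with (towards a contradiction) `|C| ≤ n^c`: the structural critical
closure `f̄` of `C` (stub 1) is `2δ`-accurate (Lemma 13: `L|K|θ ≤ 2^{C(k-1,2)}/n ≤ δ`), hence accepts the
planted clique (stub 2), hence accepts an `η`-fraction of isolated cliques (stub 5); these split into
cliques with an accepted one-edge deletion and exact clique minterms; the latter have density `< η/2`
(Lemma 14 `StarApproxInv.loc` + stub 4), so the former have density `≥ η/2` and stub 3 gives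
`Pr[f̄(G) = 1] > 1 − e^{-2}/4`, contradicting `Pr[f̄(G) = 1] ≤ 2δ + 1 − Pr[ω_k = 0] ≤ 1 − e^{-2}/2`
(`eventually_le_gnpProb_cliqueFree`). [cite: Rossman2010, §6 (pp. 8–9); this line] -/
theorem SingleThreshold_of : Summit.PneNP.PneNP.Theses.OneSlice.SingleThreshold := by
  rw [singleThreshold_iff_lib]
  intro c
  obtain ⟨k, hk5, a, hka, δP, hδP, η, hη, hPT⟩ := stub_positiveTrigger c (4 * c + 5)
  have hk2 : 2 ≤ k := by omega
  obtain ⟨δA, hδA, hPA⟩ := stub_plantedAcceptance k (by omega) δP hδP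
  set γ : ℝ := Real.exp (-2) with hγdef
  have hγ : 0 < γ := Real.exp_pos _
  have h15 := stub_selfNoiseLemma15 k (by omega) (η / 2) (γ / 4) (by positivity) (by positivity)
  have h16 := stub_fewCliqueMinterms c k a (by omega) (by omega) (by omega) (η / 2) (by positivity)
  set δ : ℝ := min (min δP δA) γ / 4 with hδdef
  have hδ : 0 < δ := by
    have : 0 < min (min δP δA) γ := lt_min (lt_min hδP hδA) hγ
    positivity
  have hδP' : δ ≤ δP / 4 := by
    have : min (min δP δA) γ ≤ δP := (min_le_left _ _).trans (min_le_left _ _)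
    rw [hδdef]; linarith
  have hδA' : δ ≤ δA / 4 := by
    have : min (min δP δA) γ ≤ δA := (min_le_left _ _).trans (min_le_right _ _)
    rw [hδdef]; linarith
  have hδγ : δ ≤ γ / 4 := by
    have : min (min δP δA) γ ≤ γ := min_le_right _ _
    rw [hδdef]; linarith
  refine ⟨k, by omega, δ, hδ, ?_⟩
  -- eventually-facts
  have hclfree : ∀ᶠ n : ℕ in atTop,
      Real.exp (-(2 * (1 : ℝ) ^ k.choose 2)) ≤ gnpProb n (pc n k) (univ.filter fun x => cliqueCount n k x = 0) :=
    eventually_le_gnpProb_cliqueFree (k := k) hk2 (p := fun n => pc n k) (b := 1) le_rfl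
      (Eventually.of_forall fun n => ⟨pc_nonneg n k, by rw [one_mul]; exact le_rfl⟩)
  have hpc4 : ∀ᶠ n : ℕ in atTop, pc n k ≤ 1 / 4 :=
    (tendsto_pc hk2).eventually_le_const (by norm_num)
  have ha0 : (0 : ℝ) < a := by
    have : (1 : ℝ) ≤ a := by exact_mod_cast (show 1 ≤ a by omega)
    linarith
  have hθ4 : ∀ᶠ n : ℕ in atTop, (n : ℝ) ^ (-(a : ℝ)) ≤ 1 / 4 :=
    ((tendsto_rpow_neg_atTop ha0).comp tendsto_natCast_atTop_atTop).eventually_le_const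
      (by norm_num)
  have hτ := eventually_errBudget_le (c := c) (k := k) (a := a) (by omega) hka hδ
  filter_upwards [hPT, hPA, h15, h16, hclfree, hpc4, hθ4, hτ, eventually_ge_atTop k,
    eventually_ge_atTop 1] with n hPTn hPAn h15n h16n hcl hpcn hθn hτn hkn hn1
  intro C hC hCerr
  by_contra hsize
  rw [not_lt] at hsize
  -- parameters at this `n`
  have hnr : (0 : ℝ) < n := by exact_mod_cast (show 0 < n by omega)
  set p : ℝ := pc n k with hpdef
  set θ : ℝ := (n : ℝ) ^ (-(a : ℝ)) with hθdef
  set K := smallI n k ∪ medJ n k with hKdef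
  have hp0 : 0 < p := Real.rpow_pos_of_pos hnr _
  have hp1 : p ≤ 1 := by linarith
  have hθ0 : 0 < θ := Real.rpow_pos_of_pos hnr _
  have hθp : θ < 1 - p := by linarith
  -- Stub 1: the structural critical closure of `C`
  obtain ⟨ap, hinl, hand, hor, hap⟩ := stub_structuralApprox hp0.le hp1 hθ0.le hθp
    (fun e => indVec_singleton_mem_smallI (n := n) (k := k) (by omega) e)
    (fun x hx y hy => sup_mem_smallI_union_medJ hx hy) C.gates (wf_gates C) hC
  have hout : OutOK C.gates.length C.output := C.wf_output
  have hfm : Monotone (ap C.output) := hap.mono _ hout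
  have hL : C.gates.length ≤ n ^ c := hsize
  -- Lemma 13 at the critical bias: `f̄` and `C` differ with probability `≤ L|K|θ ≤ δ`
  have hKcard : (#K : ℝ) ≤ ((n.choose (k - 1) * 2 ^ (k - 1).choose 2 : ℕ) : ℝ) := by
    exact_mod_cast card_smallI_union_medJ_le_pred (n := n) (k := k) (by omega) hkn
  have herrf : gnpProb n p (univ.filter fun x => ap C.output x ≠ C.eval x) ≤ δ := by
    have h1 : gnpProb n p (univ.filter fun x => ap C.output x ≠ C.eval x) ≤
        C.gates.length * (#K * θ) := by
      rw [gnpProb_filter_eq_prob]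
      refine le_trans (prob_mono hp0.le hp1 fun x hx => ?_) hap.err
      by_contra hgood
      have h := hap.agree hgood _ hout
      exact hx (((circuit_eval C x).trans h).symm)
    have h2 : (C.gates.length : ℝ) * (#K * θ) ≤
        (n : ℝ) ^ c * (((n.choose (k - 1) * 2 ^ (k - 1).choose 2 : ℕ)) : ℝ) * θ := by
      have hLr : (C.gates.length : ℝ) ≤ (n : ℝ) ^ c := by exact_mod_cast hL
      calc (C.gates.length : ℝ) * (#K * θ) ≤ (n : ℝ) ^ c * (#K * θ) :=
            mul_le_mul_of_nonneg_right hLr (by positivity)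
        _ ≤ (n : ℝ) ^ c * ((((n.choose (k - 1) * 2 ^ (k - 1).choose 2 : ℕ)) : ℝ) * θ) :=
            mul_le_mul_of_nonneg_left (mul_le_mul_of_nonneg_right hKcard hθ0.le) (by positivity)
        _ = _ := by ring
    linarith
  -- two-sided accuracy of `f̄`
  have haccf : gnpProb n p (univ.filter fun x => ap C.output x ≠ cliqueFn n k x) ≤ 2 * δ := by
    have := gnpProb_ne_le_add hp0.le hp1 (ap C.output) (fun x => C.eval x) (cliqueFn n k)
    have hCerr' : gnpProb n p (univ.filter fun x => C.eval x ≠ cliqueFn n k x) ≤ δ := hCerr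
    linarith
  -- Stub 2: planted acceptance of `f̄`
  have hpl := hPAn (ap C.output) hfm (haccf.trans (by linarith))
  -- Stub 5: isolated acceptance of `f̄`
  have hiso : η ≤ kSubsetProb n k (fun A => ap C.output (cliqueVec A) = true) :=
    hPTn C.gates C.output ap (wf_gates C) hC hL hout hinl hand hor hap (haccf.trans (by linarith)) hpl
  -- dichotomy: accepted isolated cliques have an accepted one-edge deletion or are exact minterms
  have hsplit : kSubsetProb n k (fun A => ap C.output (cliqueVec A) = true) ≤
      kSubsetProb n k (fun A => ∃ e, cliqueVec A e = true ∧
          ap C.output (Function.update (cliqueVec A) e false) = true) +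
        kSubsetProb n k (fun A => IsMinterm (ap C.output) (cliqueVec A)) := by
    have h2 := kSubsetProb_le_add (n := n) (k := k) (fun A => ap C.output (cliqueVec A) = true)
      (fun A => ∃ e, cliqueVec A e = true ∧ ap C.output (Function.update (cliqueVec A) e false) = true)
    have h3 : kSubsetProb n k (fun A => ap C.output (cliqueVec A) = true ∧
        ¬ (∃ e, cliqueVec A e = true ∧ ap C.output (Function.update (cliqueVec A) e false) = true)) ≤
        kSubsetProb n k (fun A => IsMinterm (ap C.output) (cliqueVec A)) := by
      refine kSubsetProb_mono fun A ⟨hA1, hA2⟩ => ?_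
      refine isMinterm_of_forall_update hfm hA1 fun e he => ?_
      by_contra hf
      rw [Bool.not_eq_false] at hf
      exact hA2 ⟨e, he, hf⟩
    linarith
  -- Case 2 (Lemma 14 + stub 4): exact clique minterms are rare
  have hcov : ∀ A : Finset (Fin n), #A = k → IsMinterm (ap C.output) (cliqueVec A) →
      ∃ m < C.gates.length, ∃ H ∈ medJ n k, IsMinterm (ap (.inr m)) H ∧ H ≤ cliqueVec A := by
    intro A hA hmin
    by_contra hno
    push Not at hno
    have hloc := hap.loc (cliqueVec A) (fun m hm H hH hle hJ => hno m hm H hJ hH hle) _ hout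
      (cliqueVec A) hmin le_rfl
    rw [mem_smallI, supp_cliqueVec (by rw [hA]; omega), hA] at hloc
    omega
  have hg : ∀ m < C.gates.length, Monotone (ap (.inr m)) ∧ IsClosedFn p θ K (ap (.inr m)) := by
    intro m hm
    have hw : OutOK C.gates.length (.inr m : Edges n ⊕ ℕ) := by
      intro m' h; cases h; exact hm
    exact ⟨hap.mono _ hw, hap.closed _ hw⟩
  have hcase2 : kSubsetProb n k (fun A => IsMinterm (ap C.output) (cliqueVec A)) < η / 2 :=
    h16n C.gates.length (fun m => ap (.inr m)) (ap C.output) hL hg hcov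
  -- Case 1 (stub 3): a dense family of accepted `K_A − e` forces acceptance of `G(n,p_c)` …
  have hcase1 : η / 2 ≤ kSubsetProb n k (fun A => ∃ e, cliqueVec A e = true ∧
      ap C.output (Function.update (cliqueVec A) e false) = true) := by linarith
  have hbig : 1 - γ / 4 < gnpProb n p (univ.filter fun x => ap C.output x = true) :=
    h15n (ap C.output) hfm hcase1
  -- … contradicting the rejection of clique-free graphs that accuracy gives for free
  have hneg := gnpProb_true_le (k := k) hp0.le hp1 (ap C.output)
  have hcl' : γ ≤ gnpProb n p (univ.filter fun x => cliqueCount n k x = 0) := by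
    have : Real.exp (-(2 * (1 : ℝ) ^ k.choose 2)) = γ := by rw [one_pow, mul_one]
    rw [← this]; exact hcl
  linarith

end Summit.PneNP.PneNP.Cruxes.SingleThreshold.SelfNoiseClosure

end
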